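import Summits.RiemannHypothesis.RiemannHypothesis.Theses.LiPrimeEcho
import Summits.RiemannHypothesis.RiemannHypothesis.Theorems.LiPrimeEchoDefs
import Literature.NumberTheory.LFunctions.RiemannXiLogDeriv
import Literature.NumberTheory.LFunctions.ExplicitFormulaPsiProofs
import Literature.NumberTheory.LFunctions.WeilZeroSum
import HarnessLib

/-!
# RiemannHypothesis / LiPrimeEcho — crux K3 `LiHorizontalEdges`: the horizontal edges at GOOD heights (RH-FREE)

RH-FREE [rh-li-prover].  Route `Theses/LiPrimeEcho.lean` (rung «Li PRIME-ECHO LAW» `LiTheory.LiZeroWindowEcho`, L-P(P1e);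
cell `pub/rh-li`, theory memo `theory/TARGETS.md` §7.10 step F / §12), item `LiHorizontalEdges`
(stmt-RiemannHypothesis-19248): for every `c ≥ 1` there are `N`, `C` such that for `n ≥ N` and every
`T ∈ [√n, c√n]` there is a GOOD height `T' ∈ [T, T + 1]` — no zero of `ξ` on the segment `[−1/2, 3/2] × {T'}` — with
`|liHorizTerm n T'| ≤ C log² n`, where `liHorizTerm n T' = (1/π) Im ∫_{−1/2}^{3/2} ξ'/ξ(x + iT') F_n(x + iT') dx`.

Proof = the registered birth stubs: F₁ (`goodHeight_log`) Montgomery–Vaughan Lemma 12.2 good heights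
(`ExplicitPsi.exists_goodHeight_all`: `T' ∈ [T, T+1]`, `η ∈ (0, 1]`, `1/η ≤ 2 + log(T'+2)/c₀`, every non-trivial zero
at distance `≥ η` from `T'`), with the bookkeeping `log(T' + 4)/η ≤ (2 + 1/c₀) log² n` once `√n ≥ c + 5`; F₂
(`horiz_pointwise`) the segment bound `|ξ'/ξ(σ + iT')| ≤ C₀ log(|T'| + 4)/η` (`exists_norm_logDeriv_riemannXi_le`,
Bombieri §2), `|F_n(σ + iT')| ≤ e` for `σ ≥ −1/2`, `T'² ≥ n` (`|1 − 1/s|² ≤ 1 + 2/T'²`), segment length `2`, and no zero of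
`ξ` on the segment since a zero of `ξ` is a non-trivial zero of `ζ` (`riemannXi_zero_prop`).  Nothing about the
position of the zeros is used; nothing here bears on the truth of RH.
-/

noncomputable section

-- D-0017: `Summit.<S>.<S>.…` is the designed namespace of a single-problem summit.
set_option linter.dupNamespace false

open Complex MeasureTheory intervalIntegral Set
open scoped Interval

namespace Summit.RiemannHypothesis.RiemannHypothesis.Theorems.LiTheory

open Literature.NumberTheory.LFunctions

namespace HorizontalEdges

/-- `|F_n(x + iT)| ≤ e` for `x ≥ −1/2`, `T > 0`, `T² ≥ n` (`|1 − 1/s|² = 1 + (1 − 2x)/|s|² ≤ 1 + 2/T² ≤ 1 + 2/n`). -/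
theorem norm_liWeight_le_exp (n : ℕ) {x T : ℝ} (hx : -(1 / 2 : ℝ) ≤ x) (hT : 0 < T) (hn : (n : ℝ) ≤ T ^ 2) :
    ‖liWeight n (x + T * I)‖ ≤ Real.exp 1 := by
  unfold liWeight
  rw [norm_pow]
  set s : ℂ := x + T * I with hs
  have hsim : s.im = T := by simp [hs]
  have hsre : s.re = x := by simp [hs]
  have hs0 : s ≠ 0 := fun h ↦ by rw [h, Complex.zero_im] at hsim; exact hT.ne' hsim.symm
  have hq' : 1 - 1 / s = (s - 1) / s := by field_simp
  rw [hq']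
  set q : ℝ := ‖(s - 1) / s‖ with hq
  have hq0 : 0 ≤ q := norm_nonneg _
  have hns : ‖s‖ ^ 2 = x ^ 2 + T ^ 2 := by rw [Complex.sq_norm, Complex.normSq_apply, hsre, hsim]; ring
  have hns1 : ‖s - 1‖ ^ 2 = (x - 1) ^ 2 + T ^ 2 := by
    rw [Complex.sq_norm, Complex.normSq_apply]; simp [hs]; ring
  have hq2 : q ^ 2 = ((x - 1) ^ 2 + T ^ 2) / (x ^ 2 + T ^ 2) := by rw [hq, norm_div, div_pow, hns, hns1]
  rcases Nat.eq_zero_or_pos n with h0 | hpos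
  · subst h0; simp [Real.one_le_exp_iff.2 zero_le_one]
  have hn0 : (0 : ℝ) < n := by exact_mod_cast hpos
  have hq2le : q ^ 2 ≤ 1 + 2 / n := by
    rw [hq2, div_le_iff₀ (by positivity)]
    have h2n : 2 ≤ 2 / (n : ℝ) * (x ^ 2 + T ^ 2) := by
      rw [div_mul_eq_mul_div, le_div_iff₀ hn0]; nlinarith [sq_nonneg x]
    nlinarith [sq_nonneg x]
  have hexp : (1 + 2 / (n : ℝ)) ≤ Real.exp (2 / n) := by
    have := Real.add_one_le_exp (2 / (n : ℝ)); linarith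
  have hpow : (q ^ 2) ^ n ≤ Real.exp 1 ^ 2 := by
    calc (q ^ 2) ^ n ≤ (1 + 2 / (n : ℝ)) ^ n := pow_le_pow_left₀ (sq_nonneg _) hq2le n
      _ ≤ Real.exp (2 / n) ^ n := pow_le_pow_left₀ (by positivity) hexp n
      _ = Real.exp 2 := by rw [← Real.exp_nat_mul]; congr 1; field_simp
      _ = Real.exp 1 ^ 2 := by rw [← Real.exp_nat_mul]; norm_num
  have hsq : (q ^ n) ^ 2 ≤ Real.exp 1 ^ 2 := by rw [← pow_mul, mul_comm, pow_mul]; exact hpow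
  exact (pow_le_pow_iff_left₀ (pow_nonneg hq0 n) (Real.exp_pos 1).le two_ne_zero).1 hsq

/-- **F₂ (segment bound at a separated height).**  There is `C ≥ 0` such that for `T ≥ 2`, `T ≥ √n`, `0 < η ≤ 1` with
every zero `ρ` of `ζ` with `Re ρ > 0` at distance `≥ η` from the ordinate `T`: `T ∈ liGoodHeights` and
`|liHorizTerm n T| ≤ C log(|T| + 4)/η`. -/
theorem horiz_pointwise :
    ∃ C : ℝ, 0 ≤ C ∧ ∀ (n : ℕ) (T η : ℝ), 2 ≤ T → Real.sqrt n ≤ T → 0 < η → η ≤ 1 →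
      (∀ ρ : ℂ, riemannZeta ρ = 0 → 0 < ρ.re → η ≤ |ρ.im - T|) →
        T ∈ liGoodHeights ∧ |liHorizTerm n T| ≤ C * Real.log (|T| + 4) / η := by
  obtain ⟨C, hC, hseg⟩ := exists_norm_logDeriv_riemannXi_le
  refine ⟨2 * C, by positivity, fun n T η hT2 hTn hη0 hη1 hZ ↦ ?_⟩
  have hT0 : 0 < T := by linarith
  have hTabs : 2 ≤ |T| := by rw [abs_of_pos hT0]; exact hT2
  have hseg' := hseg T η hTabs hη0 hη1 hZ
  have hlog0 : 0 ≤ Real.log (|T| + 4) := Real.log_nonneg (by linarith [abs_nonneg T])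
  have hnT : (n : ℝ) ≤ T ^ 2 := by
    have h := Real.sq_sqrt (n.cast_nonneg : (0 : ℝ) ≤ n)
    nlinarith [Real.sqrt_nonneg (n : ℝ)]
  constructor
  · -- no zero of `ξ` on the segment
    intro x _ h0
    obtain ⟨hζ, hre, -, -⟩ := riemannXi_zero_prop h0
    have hre' : 0 < (x + T * I : ℂ).re := hre
    have h := hZ _ hζ hre'
    simp at h
    linarith
  · -- the segment integral
    have hpt : ∀ x ∈ Ι (-(1 / 2 : ℝ)) (3 / 2),
        ‖logDeriv riemannXi (x + T * I) * liWeight n (x + T * I)‖ ≤ C * Real.log (|T| + 4) / η * Real.exp 1 := by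
      intro x hx
      rw [uIoc_of_le (by norm_num)] at hx
      rw [norm_mul]
      exact mul_le_mul (hseg' x ⟨hx.1.le, hx.2⟩) (norm_liWeight_le_exp n hx.1.le hT0 hnT) (norm_nonneg _)
        (by positivity)
    have hI := intervalIntegral.norm_integral_le_of_norm_le_const hpt
    have hlen : |(3 / 2 : ℝ) - -(1 / 2)| = 2 := by norm_num
    rw [hlen] at hI
    unfold liHorizTerm
    rw [abs_mul, abs_of_pos (by positivity : (0 : ℝ) < 1 / Real.pi)]
    have him := Complex.abs_im_le_norm
      (∫ x in (-(1 / 2 : ℝ))..(3 / 2 : ℝ), logDeriv riemannXi (x + T * I) * liWeight n (x + T * I))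
    have hπ : 1 / Real.pi ≤ 1 / 3 := one_div_le_one_div_of_le (by norm_num) Real.pi_gt_three.le
    have he : Real.exp 1 < 3 := lt_trans Real.exp_one_lt_d9 (by norm_num)
    have hK : 0 ≤ C * Real.log (|T| + 4) / η := by positivity
    calc 1 / Real.pi * |(∫ x in (-(1 / 2 : ℝ))..(3 / 2 : ℝ),
            logDeriv riemannXi (x + T * I) * liWeight n (x + T * I)).im|
        ≤ 1 / 3 * (C * Real.log (|T| + 4) / η * Real.exp 1 * 2) :=
          mul_le_mul hπ (him.trans hI) (abs_nonneg _) (by norm_num)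
      _ ≤ 2 * C * Real.log (|T| + 4) / η := by
          rw [show 2 * C * Real.log (|T| + 4) / η = (C * Real.log (|T| + 4) / η) * 2 by ring]
          nlinarith

/-- **F₁ (good heights with the log bookkeeping).**  For `c ≥ 1` there are `N`, `A` such that for `n ≥ N` and
`√n ≤ T ≤ c√n` some `T' ∈ [T, T+1]` and `η ∈ (0, 1]` satisfy `log(|T'| + 4)/η ≤ A log² n` and separate `T'` by `η`
from the ordinate of every zero of `ζ` with positive real part (Montgomery–Vaughan Lemma 12.2). -/
theorem goodHeight_log :
    ∀ c : ℝ, 1 ≤ c → ∃ N : ℕ, ∃ A : ℝ, ∀ n : ℕ, N ≤ n → ∀ T : ℝ, Real.sqrt n ≤ T → T ≤ c * Real.sqrt n →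
      ∃ T' η : ℝ, T ≤ T' ∧ T' ≤ T + 1 ∧ 0 < η ∧ η ≤ 1 ∧ Real.log (|T'| + 4) / η ≤ A * Real.log n ^ 2 ∧
        ∀ ρ : ℂ, riemannZeta ρ = 0 → 0 < ρ.re → η ≤ |ρ.im - T'| := by
  intro c hc
  obtain ⟨c₀, hc₀, hgh⟩ := ExplicitPsi.exists_goodHeight_all
  refine ⟨⌈(c + 5) ^ 2⌉₊, 2 + 1 / c₀, fun n hn T hT1 hT2 ↦ ?_⟩
  -- sizes
  have hc5 : (c + 5) ^ 2 ≤ (n : ℝ) := (Nat.le_ceil _).trans (by exact_mod_cast hn)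
  set s := Real.sqrt n with hs
  have hn0 : (0 : ℝ) ≤ n := by positivity
  have hss : s ^ 2 = n := by rw [hs, Real.sq_sqrt hn0]
  have hs6 : c + 5 ≤ s := by
    rw [hs, ← Real.sqrt_sq (by linarith : 0 ≤ c + 5)]; exact Real.sqrt_le_sqrt hc5
  have hs0 : 0 < s := by linarith
  have hT0 : 0 ≤ T := by linarith
  obtain ⟨T₁, hT₁l, hT₁u, η, hη0, hη1, hinv, hsep⟩ := hgh T hT0
  refine ⟨T₁, η, hT₁l, hT₁u, hη0, hη1, ?_, fun ρ hζ hre ↦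
    (hsep ρ (ZetaZeros.riemannZetaNontrivialZeros.mem_of_re_pos hζ hre)).1⟩
  -- `log(T₁ + 4) ≤ log n`, `log(T₁ + 2) ≤ log n`, `1 ≤ log n`
  have hT₁0 : 0 ≤ T₁ := hT0.trans hT₁l
  have htop : T₁ + 4 ≤ n := by
    have : (c + 5) * s ≤ s * s := mul_le_mul_of_nonneg_right hs6 hs0.le
    nlinarith
  have hn36 : (36 : ℝ) ≤ n := by nlinarith
  have hlogn1 : 1 ≤ Real.log n := by
    rw [Real.le_log_iff_exp_le (by linarith)]
    have := Real.exp_one_lt_d9; linarith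
  have hl4 : Real.log (|T₁| + 4) ≤ Real.log n := by
    rw [abs_of_nonneg hT₁0]; exact Real.log_le_log (by linarith) htop
  have hl2 : Real.log (T₁ + 2) ≤ Real.log n := Real.log_le_log (by linarith) (by linarith)
  have hl40 : 0 ≤ Real.log (|T₁| + 4) := Real.log_nonneg (by linarith [abs_nonneg T₁])
  -- `1/η ≤ (2 + 1/c₀) log n`
  have hinv' : 1 / η ≤ (2 + 1 / c₀) * Real.log n := by
    have h1 : Real.log (T₁ + 2) / c₀ ≤ Real.log n / c₀ := div_le_div_of_nonneg_right hl2 hc₀.le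
    have h2 : (2 : ℝ) ≤ 2 * Real.log n := by linarith
    calc 1 / η ≤ 2 + Real.log (T₁ + 2) / c₀ := hinv
      _ ≤ 2 * Real.log n + Real.log n / c₀ := by linarith
      _ = (2 + 1 / c₀) * Real.log n := by ring
  calc Real.log (|T₁| + 4) / η = Real.log (|T₁| + 4) * (1 / η) := by ring
    _ ≤ Real.log n * ((2 + 1 / c₀) * Real.log n) := mul_le_mul hl4 hinv' (by positivity) (by linarith)
    _ = (2 + 1 / c₀) * Real.log n ^ 2 := by ring

end HorizontalEdges

open HorizontalEdges in
/-- **Crux K3 `LiHorizontalEdges` of route `LiPrimeEcho`** (stmt-RiemannHypothesis-19248; RH-FREE): for `c ≥ 1` there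
are `N`, `C` with: for `n ≥ N` and `T ∈ [√n, c√n]` some good height `T' ∈ [T, T+1]` has `|liHorizTerm n T'| ≤ C log² n`.
Verbatim the route statement (the theory seat's `LiHorizontalEdges_of_stubs` on F₁, F₂). -/
theorem liHorizontalEdges_bound :
    ∀ c : ℝ, 1 ≤ c → ∃ N : ℕ, ∃ C : ℝ, ∀ n : ℕ, N ≤ n → ∀ T : ℝ, Real.sqrt n ≤ T → T ≤ c * Real.sqrt n →
      ∃ T' : ℝ, T ≤ T' ∧ T' ≤ T + 1 ∧ T' ∈ liGoodHeights ∧ |liHorizTerm n T'| ≤ C * Real.log n ^ 2 := by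
  intro c hc
  obtain ⟨N, A, hN⟩ := goodHeight_log c hc
  obtain ⟨C, hC0, hP⟩ := horiz_pointwise
  refine ⟨max N 4, C * A, fun n hn T hT1 hT2 ↦ ?_⟩
  have hnN : N ≤ n := le_trans (le_max_left _ _) hn
  have hn4 : (4 : ℝ) ≤ n := by exact_mod_cast le_trans (le_max_right _ _) hn
  have hs2 : 2 ≤ Real.sqrt n := by
    have : Real.sqrt 4 = 2 := by
      rw [show (4 : ℝ) = 2 ^ 2 by norm_num]; exact Real.sqrt_sq (by norm_num)
    rw [← this]; exact Real.sqrt_le_sqrt hn4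
  obtain ⟨T', η, hTT', hT'1, hη0, hη1, hlog, hsep⟩ := hN n hnN T hT1 hT2
  obtain ⟨hgood, hbd⟩ := hP n T' η (by linarith) (by linarith) hη0 hη1 hsep
  refine ⟨T', hTT', hT'1, hgood, hbd.trans ?_⟩
  rw [mul_div_assoc, mul_assoc]
  exact mul_le_mul_of_nonneg_left hlog hC0

/-- **Item `LiHorizontalEdges` of route `LiPrimeEcho`** (stmt-RiemannHypothesis-19248), closed BY NAME. -/
theorem liHorizontalEdges_proof :
    Summit.RiemannHypothesis.RiemannHypothesis.Theses.LiPrimeEcho.LiHorizontalEdges :=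
  liHorizontalEdges_bound

end Summit.RiemannHypothesis.RiemannHypothesis.Theorems.LiTheory

end
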